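import Mathlib
import HarnessLib
import Summits.CriticalPhenomena.CardyFormulaZ2.Theses.CardyMagicRigidity
import Literature.Probability.Percolation.FKLoopNestingGaussianLimit
import Literature.Probability.Percolation.FullPlaneCNL
import Literature.Probability.RandomPlanarGeometry.NestingTransform
import Literature.Probability.RandomPlanarGeometry.MillerWernerHookup

/-!
# Sketch — crux-ideate `stmt-CriticalPhenomena-4836` (`MagicFormulaT`), ideator 1, round 1

First lemmas of the idea cards `Ideas/ig-height-gap.md`, `Ideas/km-renewal-bosonisation.md`
(and the shared continuum transfer), stated over existing declarations. Nothing here is a route item.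

* `sigmaSq_eq_fkKappa` / `dklmMu_eq_fkKappa` / `sigmaSq_mul_heightGap_sq` — PROVED: DKLM's Bethe-ansatz
  constants are the SLE/imaginary-geometry constants of `CLE_{κ'(q)}`:
  `σ²(q) = κ'(q)/(2π)`, `μ(q) = 1/2 - 2/κ'(q)`, `σ²(q)·(2λ')² = 2π` with `λ' = π/√κ'` (card ig-height-gap).
* `FullPlaneCLE6Bosonisation` — the continuum statement both cards prove first ("twisted nesting field of
  full-plane CLE₆ is the free field with σ² = 3/π"), typed with the tree's `HasNestingTransform` /
  `fullPlaneCNLLaw`.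
* `TruncatedContinuityT`, `SmallLoopsNegligibleT` — the two lattice↔continuum transfer statements
  ("restrict to big loops", DKLM §5 p. 37, on 𝕋), so that
  `FullPlaneCLE6Bosonisation → TruncatedContinuityT → SmallLoopsNegligibleT → MagicFormulaT`
  is an ε/3 (Moore–Osgood) argument (not proved here: no skeleton at the ideate stage).
-/

noncomputable section

open MeasureTheory Filter Set
open scoped Real Topology

namespace Summit.CriticalPhenomena.CardyFormulaZ2.Cruxes.MagicFormulaT.Ideas

open Literature.Probability.Percolation Literature.Probability.RandomPlanarGeometry
  Literature.Probability.LatticeModels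

/-! ### Card `ig-height-gap`: DKLM's constants are imaginary-geometry constants (PROVED) -/

/-- `σ²(q) = κ'(q) / (2π)`: DKLM's variance (Cor. 10, Bethe ansatz) equals `κ'/2π` where
`κ' = fkKappa q = 4π / arccos(-√q/2)` is the FK/CLE parameter (`√q = -2cos(4π/κ')`).
Holds for every real `q` (Mathlib junk conventions agree on both sides). -/
theorem sigmaSq_eq_fkKappa (q : ℝ) : dklmSigmaSq q = fkKappa q / (2 * π) := by
  have h : -(Real.sqrt q / 2) = -Real.sqrt q / 2 := by ring
  rw [dklmSigmaSq, fkKappa_eq, h]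
  have hπ : (π : ℝ) ≠ 0 := Real.pi_pos.ne'
  field_simp
  ring

/-- `μ(q) = 1/2 - 2/κ'(q)`: DKLM's twist is the Coulomb-gas / imaginary-geometry background-charge
ratio `χ/√κ' = 1/2 - 2/κ'` (`χ = √κ'/2 - 2/√κ'`). Holds for every real `q`. -/
theorem dklmMu_eq_fkKappa (q : ℝ) : dklmMu q = 1 / 2 - 2 / fkKappa q := by
  rw [dklmMu, fkKappa_eq]
  have hπ : (π : ℝ) ≠ 0 := Real.pi_pos.ne'
  have hneg : Real.arccos (-Real.sqrt q / 2) = π - Real.arccos (Real.sqrt q / 2) := by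
    rw [show -Real.sqrt q / 2 = -(Real.sqrt q / 2) by ring, Real.arccos_neg]
  rw [hneg]
  by_cases h0 : π - Real.arccos (Real.sqrt q / 2) = 0
  · -- degenerate junk case `arccos(√q/2) = π` (both sides equal `1/2`)
    have : Real.arccos (Real.sqrt q / 2) = π := by linarith
    rw [h0, this]
    field_simp
    ring
  · field_simp
    ring

/-- **Height-gap form**: `σ²(q) · (2λ')² = 2π` with `λ' = π/√κ'` the imaginary-geometry boundary
value of `SLE_{κ'}` (so `2λ'` is the jump of the IG field across a `CLE_{κ'}` loop): DKLM's Gaussian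
limit, renormalised to unit jumps, has exactly the covariance of `h_IG / (2λ')`.
Stated for `q ∈ (0, 4]` (where `κ' ∈ [4, 8)`, all quantities positive). -/
theorem sigmaSq_mul_heightGap_sq {q : ℝ} (hq0 : 0 < q) (hq4 : q ≤ 4) :
    dklmSigmaSq q * (2 * (π / Real.sqrt (fkKappa q))) ^ 2 = 2 * π := by
  have hκ : fkKappa q ∈ Icc (4 : ℝ) 8 := fkKappa_mem_Icc hq4
  have hκpos : 0 < fkKappa q := by linarith [hκ.1]
  have hsq : Real.sqrt (fkKappa q) ^ 2 = fkKappa q := Real.sq_sqrt hκpos.le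
  have hsqrt_ne : Real.sqrt (fkKappa q) ≠ 0 := (Real.sqrt_pos.2 hκpos).ne'
  rw [sigmaSq_eq_fkKappa, mul_pow, div_pow, hsq]
  have hπ : (π : ℝ) ≠ 0 := Real.pi_pos.ne'
  field_simp

/-- At `q = 1`: `κ' = 6`, `σ² = 3/π`, `μ = 1/6`, `2λ' = 2π/√6` and `(3/π)·(2π/√6)² = 2π`. -/
example : dklmSigmaSq 1 * (2 * (π / Real.sqrt 6)) ^ 2 = 2 * π := by
  have := sigmaSq_mul_heightGap_sq (q := 1) one_pos (by norm_num)
  rwa [fkKappa_one] at this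

/-! ### The continuum statement both cards prove first -/

/-- Admissible test densities of the crux: measurable, bounded, compactly supported, mass zero. -/
def Admissible (f : ℂ → ℝ) : Prop :=
  ∃ R C : ℝ, Measurable f ∧ (∀ z, |f z| ≤ C) ∧ (∀ z, R < ‖z‖ → f z = 0) ∧ ∫ z, f z = 0

/-- The Gaussian value `exp((3/4π²) ∬ log‖x - y‖ f(x) f(y))` (`= exp(-(σ²/2)⟨f, G f⟩`, `σ² = 3/π`). -/
def gaussianValue (f : ℂ → ℝ) : ℝ :=
  Real.exp (3 / (4 * π ^ 2) * ∫ x, ∫ y, Real.log ‖x - y‖ * f x * f y)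

/-- **Full-plane CLE₆ bosonisation** (continuum form of `MagicFormulaT`): the `μ = 1/6`-twisted
nesting transform of the full-plane Camia–Newman law EXISTS (as the `ε → 0⁺` limit of the
big-loop-truncated expectations, `HasNestingTransform`) and equals the Gaussian value, for every
admissible `f`. This is the statement the cards `ig-height-gap` (via the IG coupling) and
`km-renewal-bosonisation` (via Kang–Makarov radial martingale-observables + CLE₆ renewal) attack. -/
def FullPlaneCLE6Bosonisation : Prop :=
  ∀ f : ℂ → ℝ, Admissible f →
    HasNestingTransform (volume : Measure unitInterval) fullPlaneCNLLaw f (gaussianValue f)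

/-- **Truncated continuity on 𝕋** (transfer step 1, "restrict to big loops"): for each cut-off
`ε > 0` the `ε`-truncated lattice transform of site percolation on `δ𝕋` converges, as `δ → 0⁺`, to the
`ε`-truncated transform of the full-plane CNL law (Camia–Newman convergence in `d_CN` + uniform
integrability of the bounded-by-`2^N` truncated product). -/
def TruncatedContinuityT : Prop :=
  ∀ f : ℂ → ℝ, Admissible f → ∀ ε : ℝ, 0 < ε →
    Tendsto (fun δ : ℝ ↦ truncNestingTransform (triSitePercolation half) (siteLoopConfig δ) f ε)
      (𝓝[>] 0)
      (𝓝 (truncNestingTransform (volume : Measure unitInterval) fullPlaneCNLLaw f ε))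

/-- **Small loops are negligible on 𝕋, uniformly in the mesh** (transfer step 2, DKLM §5 p. 37
`O(ε^c)`): the difference between the full lattice transform and its `ε`-truncation is small for
small `ε`, uniformly in `δ` small (RSW on 𝕋 + `∫ f = 0`). -/
def SmallLoopsNegligibleT : Prop :=
  ∀ f : ℂ → ℝ, Admissible f → ∀ η : ℝ, 0 < η → ∃ ε : ℝ, 0 < ε ∧
    ∀ᶠ δ : ℝ in 𝓝[>] 0,
      |truncNestingTransform (triSitePercolation half) (siteLoopConfig δ) f 0 -
        truncNestingTransform (triSitePercolation half) (siteLoopConfig δ) f ε| ≤ η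

/-- The lattice transform at cut-off `0` is literally the functional of the crux (sanity `rfl`-level
bridge: `truncNestingTransform_zero` + `nestingWeight_eq_finprod` + `siteLoopConfig`'s `loops`). -/
example (f : ℂ → ℝ) (δ : ℝ) :
    truncNestingTransform (triSitePercolation half) (siteLoopConfig δ) f 0 =
      ∫ cfg, (siteLoopConfig δ cfg).nestingWeight f ∂(triSitePercolation half) :=
  truncNestingTransform_zero _ _ _

/-- Shape of the transfer (the ε/3 interchange-of-limits argument; NOT proved at the ideate stage). -/
def TransferShape : Prop :=
  FullPlaneCLE6Bosonisation → TruncatedContinuityT → SmallLoopsNegligibleT →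
    Summit.CriticalPhenomena.CardyFormulaZ2.Theses.CardyMagicRigidity.MagicFormulaT

end Summit.CriticalPhenomena.CardyFormulaZ2.Cruxes.MagicFormulaT.Ideas

end
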